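import Literature.NumberTheory.GelbartRogawski1991.DoubledUnitarySiegelParabolicAlgebra
import Literature.NumberTheory.GelbartRogawski1991.DoubledGramDiagonal
import Literature.NumberTheory.GelbartRogawski1991.DoubledWeilRepresentationUndoubling
import Literature.NumberTheory.GelbartRogawski1991.DoubledWeilRepresentationArchLagrangian
import Literature.NumberTheory.Weil1964.AdelicMetaplecticSeesawSum
import HarnessLib

/-!
# The doubled block-diagonal embedding `H(V₁)(𝔸) × H(V₂)(𝔸) ↪ H(V₁ ⊕ V₂)(𝔸)` of doubled unitary groups and its see-saw clause

Topic `NumberTheory/GelbartRogawski1991`; namespace `Literature.NumberTheory.GelbartRogawski1991.GRConstruction` (the doubled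
unitary groups `H(X)(𝔸) = U(𝕎_X ⊕ 𝕎_X⁻)(𝔸_{L⁺})`, `𝕎_X = Res(X ⊗ W)`, of `DoubledUnitaryGlobalSplittingData`).  Three plumbing
definitions with bodies (the index shuffles `idxSplit`, `idxSplitD` and the embedding `blkD`) and proved theorems; no named
fact, no `sorry`.

Setting: a CM field `L`, diagonal hermitian spaces `V₁ = diag dA` (rank `N₁`), `V₂ = diag dB` (rank `N₂`), `V = diag dV`
(rank `N₁ + N₂`) with `dV = dA ‖ dB` (hypotheses `hVA`, `hVB`), ONE partner space `W = diag dW` (rank `M`), enumerations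
`eV : Fin (N₁+N₂) × Fin M ≃ Fin n`, `eA : Fin N₁ × Fin M ≃ Fin n₁`, `eB : Fin N₂ × Fin M ≃ Fin n₂`; the doubled groups `HA` on
the indices `Fin (n+n)`, `Fin (n₁+n₁)`, `Fin (n₂+n₂)`.  This is the see-saw pair `H(V₁) × H(V₂) ⊂ H(V₁ ⊕ V₂)` of
[Kudla1984, §1] in the doubled-unitary setting of [GelbartRogawski1991, §3.1] / [Kudla1994, §2].

* §1 the index shuffles `idxSplit : Fin n ≃ Fin n₁ ⊕ Fin n₂` (`(V₁ ⊕ V₂) ⊗ W = V₁ ⊗ W ⊕ V₂ ⊗ W` read through `eV, eA, eB`) and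
  **`idxSplitD : Fin (n+n) ≃ Fin (n₁+n₁) ⊕ Fin (n₂+n₂)`** (`𝕎_V^𝔻 = 𝕎_{V₁}^𝔻 ⊕ 𝕎_{V₂}^𝔻`: split each copy, then regroup with
  `Equiv.sumSumSumComm`), with their values on the four kinds of basis vectors;
* §2 **`reindex_idxSplitD_gramD`**: `reindex σ σ T^𝔻_V = T^𝔻_{V₁} ⊕ T^𝔻_{V₂}` (all three doubled Gram matrices are DIAGONAL,
  `gramD_gram_realDiagonal`, and `σ` matches the entries), with its adelic / hermitian / `adelicForm` forms;
* §3 **`blkD : H(V₁)(𝔸) × H(V₂)(𝔸) →* H(V)(𝔸)`**, `(h₁, h₂) ↦ σ⁻¹-reindex of diag(h₁, h₂)` (`UnitaryGroup.blockDiag` +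
  `reindexU`, cast along §2), `coe_blkD`, `continuous_blkD`;
* §4 **`toSpD_blkD`** — THE SEE-SAW CLAUSE `hS`: `ι^𝔻_V(blkD (h₁,h₂))` read through `σ` is `ι^𝔻_{V₁}(h₁) ⊕ ι^𝔻_{V₂}(h₂)`
  (`resAut_reindexGL` + `resAut_blockDiagGL`), in the `LinearEquiv` currency of `AdelicMetaplecticSeesawSum.mpSeesawCharSum`.

What is NOT here: the Siegel-parabolic bookkeeping of `blkD` (`isSiegelDelta_blkD`, `detDelta_blkD`, `chiDet_blkD`,
`modDelta_blkD`) and Weil's rational element `δ` through `σ` (`proj_rDelta_split`) — the sequel `DoubledBlockDiagEmbeddingDelta`;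
the see-saw scalar, the parabolic comparison and the undoubling built on them.

## References
* [Kudla1984] S. Kudla, *Seesaw dual reductive pairs*, Progr. Math. 46 (1984) 244–268, §1.
* [Kudla1994] S. Kudla, *Splitting metaplectic covers of dual reductive pairs*, Israel J. Math. 87 (1994), §2, Thm. 3.1.
* [GelbartRogawski1991] S. Gelbart, J. Rogawski, *L-functions and Fourier–Jacobi coefficients for the unitary group U(3)*,
  Invent. Math. 105 (1991), §3.1 Prop. 3.1.1 p. 455.
* [HarrisKudlaSweet1996] M. Harris, S. Kudla, W. Sweet, *Theta dichotomy for unitary groups*, J. AMS 9 (1996), §1 (1.9)–(1.15).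
-/

set_option autoImplicit false

noncomputable section

open scoped Classical
open scoped Matrix Kronecker
open NumberField IsDedekindDomain
open Literature.RepresentationTheory.HeisenbergGroup
open Literature.NumberTheory.Automorphic
open Literature.NumberTheory.Weil1964
open Literature.RepresentationTheory.HarrisKudlaSweet1996
open Literature.NumberTheory.GaloisRepresentations

namespace Literature.NumberTheory.GelbartRogawski1991.GRConstruction

open UnitaryDualPair

variable (L : Type) [Field L] [NumberField L] [IsCMField L]

variable {N₁ N₂ M n n₁ n₂ : ℕ} (eV : Fin (N₁ + N₂) × Fin M ≃ Fin n) (eA : Fin N₁ × Fin M ≃ Fin n₁)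
  (eB : Fin N₂ × Fin M ≃ Fin n₂)

/-! ## §1 The index shuffles -/

section Index

/-- `Fin n ≃ Fin n₁ ⊕ Fin n₂`: the decomposition `(V₁ ⊕ V₂) ⊗ W = (V₁ ⊗ W) ⊕ (V₂ ⊗ W)` read through the enumerations
`eV, eA, eB` (`e_Σ` of ★ `UnitaryDualPairSeesawCharacterLeft`, then `eA ⊕ eB`). [cite: Kudla1984, §1] -/
def idxSplit : Fin n ≃ Fin n₁ ⊕ Fin n₂ :=
  eV.symm.trans ((((finSumFinEquiv.prodCongr (Equiv.refl (Fin M))).symm.trans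
    (Equiv.sumProdDistrib (Fin N₁) (Fin N₂) (Fin M))).trans (eA.sumCongr eB)))

/-- **`σ : Fin (n+n) ≃ Fin (n₁+n₁) ⊕ Fin (n₂+n₂)`**: `𝕎_V ⊕ 𝕎_V⁻ = (𝕎_{V₁} ⊕ 𝕎_{V₁}⁻) ⊕ (𝕎_{V₂} ⊕ 𝕎_{V₂}⁻)` — split each of the
two copies by `idxSplit`, regroup by `Equiv.sumSumSumComm`, re-enumerate by `finSumFinEquiv`. [cite: Kudla1984, §1]
[cite: Kudla1994, §2 (doubled space, Siegel parabolic)] -/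
def idxSplitD : Fin (n + n) ≃ Fin (n₁ + n₁) ⊕ Fin (n₂ + n₂) :=
  (finSumFinEquiv (m := n) (n := n)).symm.trans
    ((((idxSplit eV eA eB).sumCongr (idxSplit eV eA eB)).trans
      ((Equiv.sumSumSumComm (Fin n₁) (Fin n₂) (Fin n₁) (Fin n₂)).trans
        ((finSumFinEquiv (m := n₁) (n := n₁)).sumCongr (finSumFinEquiv (m := n₂) (n := n₂))))))

/-- value of `idxSplit⁻¹` on the first summand: the basis vector `(castAdd i, j)` of `V ⊗ W`. [cite: Kudla1984, §1] -/
theorem eV_symm_idxSplit_symm_inl (m : Fin n₁) :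
    eV.symm ((idxSplit eV eA eB).symm (Sum.inl m)) = (Fin.castAdd N₂ (eA.symm m).1, (eA.symm m).2) := by
  simp [idxSplit]

/-- value of `idxSplit⁻¹` on the second summand: the basis vector `(natAdd i, j)` of `V ⊗ W`. [cite: Kudla1984, §1] -/
theorem eV_symm_idxSplit_symm_inr (m : Fin n₂) :
    eV.symm ((idxSplit eV eA eB).symm (Sum.inr m)) = (Fin.natAdd N₁ (eB.symm m).1, (eB.symm m).2) := by
  simp [idxSplit]

/-- `σ` on the first copy: `σ (e₂ (inl k)) = inl (e₂ (inl m))` resp. `inr (e₂ (inl m))` according as `idxSplit k = inl m`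
resp. `inr m`. [cite: Kudla1984, §1] -/
theorem idxSplitD_apply_inl (k : Fin n) :
    idxSplitD eV eA eB (finSumFinEquiv (Sum.inl k)) =
      Sum.map (fun m => finSumFinEquiv (m := n₁) (n := n₁) (Sum.inl m))
        (fun m => finSumFinEquiv (m := n₂) (n := n₂) (Sum.inl m)) (idxSplit eV eA eB k) := by
  simp only [idxSplitD, Equiv.trans_apply, Equiv.symm_apply_apply, Equiv.sumCongr_apply, Sum.map_inl]
  rcases idxSplit eV eA eB k with m | m <;> simp

/-- `σ` on the second copy. [cite: Kudla1984, §1] -/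
theorem idxSplitD_apply_inr (k : Fin n) :
    idxSplitD eV eA eB (finSumFinEquiv (Sum.inr k)) =
      Sum.map (fun m => finSumFinEquiv (m := n₁) (n := n₁) (Sum.inr m))
        (fun m => finSumFinEquiv (m := n₂) (n := n₂) (Sum.inr m)) (idxSplit eV eA eB k) := by
  simp only [idxSplitD, Equiv.trans_apply, Equiv.symm_apply_apply, Equiv.sumCongr_apply, Sum.map_inr]
  rcases idxSplit eV eA eB k with m | m <;> simp

/-- `σ⁻¹ (inl (e₂ (inl m))) = e₂ (inl (idxSplit⁻¹ (inl m)))`. [cite: Kudla1984, §1] -/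
theorem idxSplitD_symm_inl_inl (m : Fin n₁) :
    (idxSplitD eV eA eB).symm (Sum.inl (finSumFinEquiv (Sum.inl m))) =
      finSumFinEquiv (Sum.inl ((idxSplit eV eA eB).symm (Sum.inl m))) := by
  rw [Equiv.symm_apply_eq, idxSplitD_apply_inl, Equiv.apply_symm_apply, Sum.map_inl]

/-- `σ⁻¹ (inl (e₂ (inr m))) = e₂ (inr (idxSplit⁻¹ (inl m)))`. [cite: Kudla1984, §1] -/
theorem idxSplitD_symm_inl_inr (m : Fin n₁) :
    (idxSplitD eV eA eB).symm (Sum.inl (finSumFinEquiv (Sum.inr m))) =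
      finSumFinEquiv (Sum.inr ((idxSplit eV eA eB).symm (Sum.inl m))) := by
  rw [Equiv.symm_apply_eq, idxSplitD_apply_inr, Equiv.apply_symm_apply, Sum.map_inl]

/-- `σ⁻¹ (inr (e₂ (inl m))) = e₂ (inl (idxSplit⁻¹ (inr m)))`. [cite: Kudla1984, §1] -/
theorem idxSplitD_symm_inr_inl (m : Fin n₂) :
    (idxSplitD eV eA eB).symm (Sum.inr (finSumFinEquiv (Sum.inl m))) =
      finSumFinEquiv (Sum.inl ((idxSplit eV eA eB).symm (Sum.inr m))) := by
  rw [Equiv.symm_apply_eq, idxSplitD_apply_inl, Equiv.apply_symm_apply, Sum.map_inr]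

/-- `σ⁻¹ (inr (e₂ (inr m))) = e₂ (inr (idxSplit⁻¹ (inr m)))`. [cite: Kudla1984, §1] -/
theorem idxSplitD_symm_inr_inr (m : Fin n₂) :
    (idxSplitD eV eA eB).symm (Sum.inr (finSumFinEquiv (Sum.inr m))) =
      finSumFinEquiv (Sum.inr ((idxSplit eV eA eB).symm (Sum.inr m))) := by
  rw [Equiv.symm_apply_eq, idxSplitD_apply_inr, Equiv.apply_symm_apply, Sum.map_inr]

end Index

/-! ## §2 The doubled Gram matrices: `reindex σ σ T^𝔻_V = T^𝔻_{V₁} ⊕ T^𝔻_{V₂}` -/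

section Gram

variable (dA : Fin N₁ → L) (hdA : ∀ i, IsCMField.complexConj L (dA i) = dA i)
  (dB : Fin N₂ → L) (hdB : ∀ i, IsCMField.complexConj L (dB i) = dB i)
  (dV : Fin (N₁ + N₂) → L) (hdV : ∀ i, IsCMField.complexConj L (dV i) = dV i)
  (hVA : ∀ i, dV (Fin.castAdd N₂ i) = dA i) (hVB : ∀ j, dV (Fin.natAdd N₁ j) = dB j)
  (dW : Fin M → L) (hdW : ∀ i, IsCMField.complexConj L (dW i) = dW i)

/-- the doubled Gram matrix of record IS ★ `LocalSplitting.gramD` of the datum's `gram` (definitional), hence DIAGONAL with entries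
`(t₀ ⊕ (−t₀)) ∘ e₂⁻¹`, `t₀ = cmGramEntry`. [cite: HarrisKudlaSweet1996, §1 (1.9)] -/
theorem gramD_eq_diagonal {N : ℕ} (e : Fin N × Fin M ≃ Fin n) (d : Fin N → L) (hd : ∀ i, IsCMField.complexConj L (d i) = d i) :
    gramD L e d hd dW hdW =
      Matrix.diagonal fun k => Sum.elim (cmGramEntry L e d hd dW hdW) (-cmGramEntry L e d hd dW hdW)
        ((finSumFinEquiv (m := n) (n := n)).symm k) :=
  gramD_gram_realDiagonal L e d hd dW hdW

include hVA in
/-- the Gram entries of `V ⊗ W` on the first summand are those of `V₁ ⊗ W`. [cite: HarrisKudlaSweet1996, §1 (1.9)] -/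
theorem cmGramEntry_idxSplit_symm_inl (m : Fin n₁) :
    cmGramEntry L eV dV hdV dW hdW ((idxSplit eV eA eB).symm (Sum.inl m)) = cmGramEntry L eA dA hdA dW hdW m := by
  apply Subtype.ext
  rw [coe_cmGramEntry, coe_cmGramEntry, eV_symm_idxSplit_symm_inl, hVA]

include hVB in
/-- the Gram entries of `V ⊗ W` on the second summand are those of `V₂ ⊗ W`. [cite: HarrisKudlaSweet1996, §1 (1.9)] -/
theorem cmGramEntry_idxSplit_symm_inr (m : Fin n₂) :
    cmGramEntry L eV dV hdV dW hdW ((idxSplit eV eA eB).symm (Sum.inr m)) = cmGramEntry L eB dB hdB dW hdW m := by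
  apply Subtype.ext
  rw [coe_cmGramEntry, coe_cmGramEntry, eV_symm_idxSplit_symm_inr, hVB]

include hVA hVB in
/-- **`reindex σ σ T^𝔻_V = T^𝔻_{V₁} ⊕ T^𝔻_{V₂}`** over `L⁺`. [cite: Kudla1984, §1] [cite: Kudla1994, §2 (doubled space, Siegel parabolic)] -/
theorem reindex_idxSplitD_gramD :
    Matrix.reindex (idxSplitD eV eA eB) (idxSplitD eV eA eB) (gramD L eV dV hdV dW hdW) =
      Matrix.fromBlocks (gramD L eA dA hdA dW hdW) 0 0 (gramD L eB dB hdB dW hdW) := by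
  rw [gramD_eq_diagonal, gramD_eq_diagonal, gramD_eq_diagonal, Matrix.fromBlocks_diagonal, Matrix.reindex_apply,
    Matrix.submatrix_diagonal_equiv]
  congr 1
  funext K
  rcases K with K | K
  · obtain ⟨z, rfl⟩ := (finSumFinEquiv (m := n₁) (n := n₁)).surjective K
    rcases z with m | m
    · rw [Function.comp_apply, idxSplitD_symm_inl_inl, Sum.elim_inl, Equiv.symm_apply_apply, Equiv.symm_apply_apply,
        Sum.elim_inl, Sum.elim_inl, cmGramEntry_idxSplit_symm_inl L eV eA eB dA hdA dV hdV hVA dW hdW]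
    · rw [Function.comp_apply, idxSplitD_symm_inl_inr, Sum.elim_inl, Equiv.symm_apply_apply, Equiv.symm_apply_apply,
        Sum.elim_inr, Sum.elim_inr, Pi.neg_apply, Pi.neg_apply, cmGramEntry_idxSplit_symm_inl L eV eA eB dA hdA dV hdV hVA dW hdW]
  · obtain ⟨z, rfl⟩ := (finSumFinEquiv (m := n₂) (n := n₂)).surjective K
    rcases z with m | m
    · rw [Function.comp_apply, idxSplitD_symm_inr_inl, Sum.elim_inr, Equiv.symm_apply_apply, Equiv.symm_apply_apply,
        Sum.elim_inl, Sum.elim_inl, cmGramEntry_idxSplit_symm_inr L eV eA eB dB hdB dV hdV hVB dW hdW]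
    · rw [Function.comp_apply, idxSplitD_symm_inr_inr, Sum.elim_inr, Equiv.symm_apply_apply, Equiv.symm_apply_apply,
        Sum.elim_inr, Sum.elim_inr, Pi.neg_apply, Pi.neg_apply, cmGramEntry_idxSplit_symm_inr L eV eA eB dB hdB dV hdV hVB dW hdW]

include hVA hVB in
/-- **`reindex σ σ (T^𝔻_V ⊗ 1) = (T^𝔻_{V₁} ⊗ 1) ⊕ (T^𝔻_{V₂} ⊗ 1)`** over `𝔸_{L⁺}` — the hypothesis `hT` of ★ `mpSeesawCharSum` /
`sumTransport` along `σ`. [cite: Kudla1984, §1] -/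
theorem reindex_idxSplitD_gramDA :
    Matrix.reindex (idxSplitD eV eA eB) (idxSplitD eV eA eB) (gramDA L eV dV hdV dW hdW) =
      Matrix.fromBlocks (gramDA L eA dA hdA dW hdW) 0 0 (gramDA L eB dB hdB dW hdW) := by
  unfold gramDA
  rw [← UnitaryGroup.reindex_map, reindex_idxSplitD_gramD L eV eA eB dA hdA dB hdB dV hdV hVA hVB dW hdW,
    Matrix.fromBlocks_map, Matrix.map_zero _ (map_zero _), Matrix.map_zero _ (map_zero _)]

include hVA hVB in
/-- `reindex σ σ J^𝔻_V = J^𝔻_{V₁} ⊕ J^𝔻_{V₂}` over `L`. [cite: Kudla1984, §1] -/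
theorem reindex_idxSplitD_hermD :
    Matrix.reindex (idxSplitD eV eA eB) (idxSplitD eV eA eB) (hermD L eV dV hdV dW hdW) =
      Matrix.fromBlocks (hermD L eA dA hdA dW hdW) 0 0 (hermD L eB dB hdB dW hdW) := by
  unfold hermD
  rw [← UnitaryGroup.reindex_map, reindex_idxSplitD_gramD L eV eA eB dA hdA dB hdB dV hdV hVA hVB dW hdW,
    Matrix.fromBlocks_map, Matrix.map_zero _ (map_zero _), Matrix.map_zero _ (map_zero _)]

include hVA hVB in
/-- the adelic hermitian form of `V`'s doubled space is the `σ⁻¹`-re-enumerated block form of those of `V₁`, `V₂`.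
[cite: Kudla1984, §1] -/
theorem adelicForm_hermD_split :
    UnitaryGroup.adelicForm L (n + n) (hermD L eV dV hdV dW hdW) =
      Matrix.reindex (idxSplitD eV eA eB).symm (idxSplitD eV eA eB).symm
        (Matrix.fromBlocks (UnitaryGroup.adelicForm L (n₁ + n₁) (hermD L eA dA hdA dW hdW)) 0 0
          (UnitaryGroup.adelicForm L (n₂ + n₂) (hermD L eB dB hdB dW hdW))) := by
  unfold UnitaryGroup.adelicForm
  rw [show Matrix.fromBlocks ((hermD L eA dA hdA dW hdW).map (algebraMap L (AdeleRing (𝓞 L) L))) 0 0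
        ((hermD L eB dB hdB dW hdW).map (algebraMap L (AdeleRing (𝓞 L) L))) =
      (Matrix.fromBlocks (hermD L eA dA hdA dW hdW) 0 0 (hermD L eB dB hdB dW hdW)).map (algebraMap L (AdeleRing (𝓞 L) L)) by
    rw [Matrix.fromBlocks_map, Matrix.map_zero _ (map_zero _), Matrix.map_zero _ (map_zero _)],
    ← reindex_idxSplitD_hermD L eV eA eB dA hdA dB hdB dV hdV hVA hVB dW hdW, UnitaryGroup.reindex_map]
  ext i j
  simp only [Matrix.reindex_apply, Matrix.submatrix_apply, Equiv.symm_symm, Equiv.symm_apply_apply]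

end Gram

/-! ## §3 The doubled block-diagonal embedding `blkD : H(V₁)(𝔸) × H(V₂)(𝔸) →* H(V)(𝔸)` -/

section Blk

variable (dA : Fin N₁ → L) (hdA : ∀ i, IsCMField.complexConj L (dA i) = dA i)
  (dB : Fin N₂ → L) (hdB : ∀ i, IsCMField.complexConj L (dB i) = dB i)
  (dV : Fin (N₁ + N₂) → L) (hdV : ∀ i, IsCMField.complexConj L (dV i) = dV i)
  (hVA : ∀ i, dV (Fin.castAdd N₂ i) = dA i) (hVB : ∀ j, dV (Fin.natAdd N₁ j) = dB j)
  (dW : Fin M → L) (hdW : ∀ i, IsCMField.complexConj L (dW i) = dW i)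

local notation "𝔸L" => AdeleRing (𝓞 L) L
local notation "𝔸⁺" => AdeleRing (𝓞 (Fp L)) (Fp L)

/-- **`blkD : H(V₁)(𝔸) × H(V₂)(𝔸) →* H(V₁ ⊕ V₂)(𝔸)`**, `(h₁, h₂) ↦ σ⁻¹-re-enumeration of `diag(h₁, h₂)` — the doubled groups of
the two summands of `V = V₁ ⊕ V₂` (same partner `W`) inside the doubled group of `V` (★ `UnitaryGroup.blockDiag`, ★ `reindexU`,
cast along `adelicForm_hermD_split`; the pattern of ★ `inlG` / `diagG`). [cite: Kudla1984, §1] [cite: Kudla1994, §2 (doubled space, Siegel parabolic)] -/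
def blkD : HA L eA dA hdA dW hdW × HA L eB dB hdB dW hdW →* HA L eV dV hdV dW hdW :=
  (Subgroup.inclusion (le_of_eq (congrArg (unitaryGroupOfForm (UnitaryGroup.conjAdele (Fp L) L (IsCMField.complexConj L)))
      (adelicForm_hermD_split L eV eA eB dA hdA dB hdB dV hdV hVA hVB dW hdW).symm))).comp <|
    (UnitaryGroup.reindexU _ (idxSplitD eV eA eB).symm _).comp (UnitaryGroup.blockDiag _ _ _)

/-- the GL-matrix of `blkD (h₁, h₂)`: `reindex σ⁻¹ (diag (h₁, h₂))`. [cite: Kudla1984, §1] -/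
theorem coe_blkD (h : HA L eA dA hdA dW hdW × HA L eB dB hdB dW hdW) :
    ((blkD L eV eA eB dA hdA dB hdB dV hdV hVA hVB dW hdW h : HA L eV dV hdV dW hdW) : GL (Fin (n + n)) 𝔸L) =
      UnitaryGroup.reindexGL (idxSplitD eV eA eB).symm
        (UnitaryGroup.blockDiagGL ((h.1 : GL (Fin (n₁ + n₁)) 𝔸L), (h.2 : GL (Fin (n₂ + n₂)) 𝔸L))) :=
  rfl

/-- the matrix of `blkD (h₁, h₂)`: entry `(i, j)` is `diag(h₁, h₂) (σ i) (σ j)`. [cite: Kudla1984, §1] -/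
theorem coe_coe_blkD_apply (h : HA L eA dA hdA dW hdW × HA L eB dB hdB dW hdW) (i j : Fin (n + n)) :
    (((blkD L eV eA eB dA hdA dB hdB dV hdV hVA hVB dW hdW h : HA L eV dV hdV dW hdW) : GL (Fin (n + n)) 𝔸L) :
        Matrix (Fin (n + n)) (Fin (n + n)) 𝔸L) i j =
      Matrix.fromBlocks ((h.1 : GL (Fin (n₁ + n₁)) 𝔸L) : Matrix (Fin (n₁ + n₁)) (Fin (n₁ + n₁)) 𝔸L) 0 0
        ((h.2 : GL (Fin (n₂ + n₂)) 𝔸L) : Matrix (Fin (n₂ + n₂)) (Fin (n₂ + n₂)) 𝔸L)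
        (idxSplitD eV eA eB i) (idxSplitD eV eA eB j) := by
  rw [coe_blkD, UnitaryGroup.coe_reindexGL, UnitaryGroup.coe_blockDiagGL, Matrix.reindex_apply, Matrix.submatrix_apply,
    Equiv.symm_symm]

/-- `blkD` is continuous. [cite: Kudla1984, §1] -/
theorem continuous_blkD : Continuous (blkD L eV eA eB dA hdA dB hdB dV hdV hVA hVB dW hdW) := by
  refine continuous_induced_rng.2 ?_
  change Continuous fun h => ((blkD L eV eA eB dA hdA dB hdB dV hdV hVA hVB dW hdW h : HA L eV dV hdV dW hdW) :
    GL (Fin (n + n)) 𝔸L)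
  simp only [coe_blkD]
  exact (UnitaryGroup.continuous_reindexGL _).comp (UnitaryGroup.continuous_blockDiagGL.comp
    ((continuous_subtype_val.comp continuous_fst).prodMk (continuous_subtype_val.comp continuous_snd)))

/-! ## §4 The see-saw clause: `ι^𝔻_V ∘ blkD` read through `σ` is `ι^𝔻_{V₁} ⊕ ι^𝔻_{V₂}` -/

/-- **THE SEE-SAW CLAUSE `hS`** (hypothesis shape of ★ `mpSeesawCharSum` along `σ`, at the `LinearEquiv` level):
`σ ∘ ι^𝔻_V(blkD (h₁, h₂)) ∘ σ⁻¹ = ι^𝔻_{V₁}(h₁) ⊕ ι^𝔻_{V₂}(h₂)` — restriction of scalars commutes with re-enumeration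
(★ `resAut_reindexGL`) and with block sums (★ `resAut_blockDiagGL`). [cite: Kudla1984, §1] [cite: Kudla1994, §2 (doubled space, Siegel parabolic)] -/
theorem toSpD_blkD (h : HA L eA dA hdA dW hdW × HA L eB dB hdB dW hdW) :
    (UnitaryGroup.spReindex (idxSplitD eV eA eB) (gramDA L eV dV hdV dW hdW)
        (toSpD L eV dV hdV dW hdW (blkD L eV eA eB dA hdA dB hdB dV hdV hVA hVB dW hdW h))).1 =
      (UnitaryGroup.spSum (gramDA L eA dA hdA dW hdW) (gramDA L eB dB hdB dW hdW)
        (toSpD L eA dA hdA dW hdW h.1, toSpD L eB dB hdB dW hdW h.2)).1 := by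
  -- `ι^𝔻_V (blkD h) = Res (reindex σ⁻¹ (diag (h₁, h₂))) = σ⁻¹ ∘ (Res h₁ ⊕ Res h₂) ∘ σ` (definitional unfoldings + the two ★ lemmas)
  have key : (toSpD L eV dV hdV dW hdW (blkD L eV eA eB dA hdA dB hdB dV hdV hVA hVB dW hdW h)).1 =
      ((UnitaryGroup.reindexW 𝔸⁺ (idxSplitD eV eA eB).symm).symm.trans
        (UnitaryGroup.spSumEquiv ((toSpD L eA dA hdA dW hdW h.1).1) ((toSpD L eB dB hdB dW hdW h.2).1))).trans
        (UnitaryGroup.reindexW 𝔸⁺ (idxSplitD eV eA eB).symm) := by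
    change (qc L).resAut (Fin (n + n)) (UnitaryGroup.reindexGL (idxSplitD eV eA eB).symm
        (UnitaryGroup.blockDiagGL ((h.1 : GL (Fin (n₁ + n₁)) 𝔸L), (h.2 : GL (Fin (n₂ + n₂)) 𝔸L)))) = _
    rw [(qc L).resAut_reindexGL, (qc L).resAut_blockDiagGL]
    rfl
  refine LinearEquiv.ext fun v => ?_
  change UnitaryGroup.reindexW 𝔸⁺ (idxSplitD eV eA eB)
      ((toSpD L eV dV hdV dW hdW (blkD L eV eA eB dA hdA dB hdB dV hdV hVA hVB dW hdW h)).1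
        ((UnitaryGroup.reindexW 𝔸⁺ (idxSplitD eV eA eB)).symm v)) =
    UnitaryGroup.spSumEquiv ((toSpD L eA dA hdA dW hdW h.1).1) ((toSpD L eB dB hdB dW hdW h.2).1) v
  rw [key]
  obtain ⟨a, b⟩ := v
  simp only [LinearEquiv.trans_apply, UnitaryGroup.reindexW_apply, UnitaryGroup.reindexW_symm_apply, Equiv.symm_symm]
  have hab : ∀ c : Fin (n₁ + n₁) ⊕ Fin (n₂ + n₂) → 𝔸⁺,
      (c ∘ ⇑(idxSplitD eV eA eB)) ∘ ⇑(idxSplitD eV eA eB).symm = c := fun c =>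
    funext fun i => by simp only [Function.comp_apply, Equiv.apply_symm_apply]
  rw [hab a, hab b]
  refine Prod.ext (funext fun i => ?_) (funext fun i => ?_) <;>
    simp only [Function.comp_apply, Equiv.apply_symm_apply]

end Blk

end Literature.NumberTheory.GelbartRogawski1991.GRConstruction

end
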